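import Literature.Computability.Complexity.SymmetricCircuit
import Literature.Computability.Complexity.CircuitComposition
import Literature.Computability.Complexity.NegationElimination
import Summits.PneNP.PneNP.Theorems.SymmetryBudgetWindowBarrierStubHeaderHardwiring

/-!
# `WindowBarrier` (stmt-PneNP-2145) — negative-side support V: symmetric composition in the
# straight-line circuit model (`τ ⊕ id`, `τ ⊕ σ`)

Route `PneNP/SymmetryBudget`, crux rank 4 (`Summit.PneNP.PneNP.Theses.SymmetryBudget.WindowBarrier`).
Sorry-free, by the crux disprover (cdisprove seat, cycle 2). Nothing here asserts a route item; the
consequence for the crux ("a symmetric canoniser in the window refutes it", BN2's target T1) is the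
companion file `Negative/SymCanonisation.lean`.

## Symmetric composition in the straight-line model

A *symmetric multi-output prefix* is a well-formed gate list `gs` over matrix inputs together with
designated wires (its outputs) such that every `ρ ∈ Γ` extends to a permutation `τ` of the gates of
`gs` satisfying the gate conditions of `Circuit.IsInducedAut` and FIXING each designated wire. The two
composition facts symmetric-circuit arguments use all the time (Anderson–Dawar 2017 §2), checked for
`Literature.Computability.Complexity.Circuit`:

* `exists_relocPerm` — THE composition lemma: relocating a circuit `D` (inputs `ι'`, automorphism
  `σ` extending `π'`) behind `gs` along a wiring `φ : ι' → wires of gs` that intertwines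
  (`relabelWire π τ (φ i) = φ (π' i)`) yields the automorphism `τ ⊕ σ` of the composite program;
  with `exists_top`, `eval_top` (`= D.eval` of the values on the wires `φ`), `size_top`, `isOver_top`.
* `exists_isInducedAut_top` / `isSymmetricUnder_top` — the case `π' = id, σ = 1`: hard-wiring an
  ARBITRARY circuit (no symmetry assumed) onto FIXED wires of a symmetric prefix gives a `Γ`-symmetric
  circuit (`τ ⊕ id`). The arity-`0`-prefix case is the lead's
  `HeaderHardwiring.exists_isInducedAut_hardwire` (S3).
* `exists_snocPerm` — the case `φ = inl, π' = π`: appending a `Γ`-symmetric single-output circuit `C`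
  (reading the inputs directly) gives a symmetric prefix with one more fixed wire, `C`'s shifted
  output. So prefixes are built from ordinary symmetric circuits, and probe/counting gadgets
  (`Negative/ProbeCount.lean`, any input type) can be stacked on them.

-/

namespace Summit.PneNP.WindowBarrier.Negative

open scoped Classical
open Literature.Computability.Complexity Literature.Computability.Complexity.GateList
open Summit.PneNP.PneNP.Theorems.HeaderHardwiring

/-! ### Permutations: `τ ⊕ id` and `τ ⊕ σ` -/

section Perms

/-- `relabelGate` of a composite permutation. -/
theorem relabelGate_trans {N : ℕ} (θ₁ θ₂ : Equiv.Perm (Fin N)) (k : ℕ) :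
    Circuit.relabelGate (θ₁.trans θ₂) k = Circuit.relabelGate θ₂ (Circuit.relabelGate θ₁ k) := by
  by_cases hk : k < N
  · rw [Circuit.relabelGate_of_lt _ hk, Circuit.relabelGate_of_lt θ₁ hk,
      Circuit.relabelGate_of_lt θ₂ (θ₁ ⟨k, hk⟩).2, Equiv.trans_apply]
  · rw [Circuit.relabelGate_of_le _ (not_lt.1 hk), Circuit.relabelGate_of_le θ₁ (not_lt.1 hk),
      Circuit.relabelGate_of_le θ₂ (not_lt.1 hk)]

/-- **`τ ⊕ id`.** A permutation of the first `L` indices extended by the identity above `L`. -/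
theorem exists_extendPerm {N L : ℕ} (hL : L ≤ N) (τ : Equiv.Perm (Fin L)) :
    ∃ θ : Equiv.Perm (Fin N), ∀ k : ℕ,
      Circuit.relabelGate θ k = if k < L then Circuit.relabelGate τ k else k := by
  have hlt : ∀ (η : Equiv.Perm (Fin L)) {v : ℕ}, v < N →
      (if v < L then Circuit.relabelGate η v else v) < N := by
    intro η v hv
    split_ifs with h
    · exact (Circuit.relabelGate_lt η h).trans_le hL
    · exact hv
  have hinv : ∀ (η : Equiv.Perm (Fin L)) {v : ℕ}, v < N →
      (if (if v < L then Circuit.relabelGate η v else v) < L then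
          Circuit.relabelGate η.symm (if v < L then Circuit.relabelGate η v else v)
        else (if v < L then Circuit.relabelGate η v else v)) = v := by
    intro η v hv
    by_cases h : v < L
    · simp only [if_pos h, if_pos (Circuit.relabelGate_lt η h)]
      exact relabelGate_symm_relabelGate η h
    · simp only [if_neg h]
  refine ⟨⟨fun i => ⟨if (i : ℕ) < L then Circuit.relabelGate τ i else i, hlt τ i.2⟩,
    fun i => ⟨if (i : ℕ) < L then Circuit.relabelGate τ.symm i else i, hlt τ.symm i.2⟩,
    fun i => Fin.ext (hinv τ i.2),
    fun i => Fin.ext (by simpa only [Equiv.symm_symm] using hinv τ.symm i.2)⟩, fun k => ?_⟩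
  by_cases hk : k < N
  · rw [Circuit.relabelGate_of_lt _ hk]
    rfl
  · have h1 : ¬ k < L := by omega
    rw [Circuit.relabelGate_of_le _ (not_lt.1 hk), if_neg h1]

/-- **`τ ⊕ σ`.** `τ` on the first `L` indices, `σ` shifted by `L` on the next `n`. -/
theorem exists_sumPerm {N L n : ℕ} (hN : N = n + L) (τ : Equiv.Perm (Fin L)) (σ : Equiv.Perm (Fin n)) :
    ∃ θ : Equiv.Perm (Fin N), ∀ k : ℕ,
      Circuit.relabelGate θ k =
        if k < L then Circuit.relabelGate τ k else Circuit.relabelGate σ (k - L) + L := by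
  obtain ⟨θ₁, h₁⟩ := exists_extendPerm (by omega : L ≤ N) τ
  obtain ⟨θ₂, h₂⟩ := exists_liftPerm L hN σ
  refine ⟨θ₁.trans θ₂, fun k => ?_⟩
  rw [relabelGate_trans, h₁]
  by_cases hk : k < L
  · rw [if_pos hk, h₂, if_pos (Circuit.relabelGate_lt τ hk), if_pos hk]
  · rw [if_neg hk, h₂, if_neg hk, if_neg hk]

variable {ι : Type*}

/-- Two relabellings that agree on gate indices `< L` agree on every wire referring below `L`. -/
theorem relabelWire_eq_of_refs_lt {n N L : ℕ} (π : ι → ι) (τ : Equiv.Perm (Fin n))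
    (θ : Equiv.Perm (Fin N)) (hθ : ∀ k, k < L → Circuit.relabelGate θ k = Circuit.relabelGate τ k)
    (w : ι ⊕ ℕ) (hw : ∀ k, w = Sum.inr k → k < L) :
    Circuit.relabelWire π θ w = Circuit.relabelWire π τ w := by
  cases w with
  | inl i => rfl
  | inr k => simp only [Circuit.relabelWire_inr, hθ k (hw k rfl)]

/-- The argument list of gate `j` of a well-formed program refers only below `j`. -/
theorem refs_lt_of_wf {gs : List (Gate ι)} (hwf : WF gs) {j : ℕ} (hj : j < gs.length)
    {w : ι ⊕ ℕ} (hw : w ∈ List.ofFn (gs[j]).args) (k : ℕ) (hk : w = Sum.inr k) : k < j := by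
  obtain ⟨a, rfl⟩ := List.mem_ofFn.1 hw
  exact hwf j (gs[j]) (List.getElem?_eq_getElem hj) a k hk

end Perms

/-! ### Relocating a circuit behind a symmetric prefix along an equivariant wiring (`τ ⊕ σ`) -/

section Top

variable {ι ι' : Type*}

/-- The composite program exists as a `Circuit`. -/
theorem exists_top (gs : List (Gate ι)) (hwf : WF gs) (D : Circuit ι') (φ : ι' → ι ⊕ ℕ)
    (hφ : WiresOK gs.length φ) :
    ∃ E : Circuit ι, E.gates = gs ++ D.gates.map (reloc φ gs.length) ∧
      E.output = shiftWire φ gs.length D.output := by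
  have hout : WiresOK D.gates.length (fun _ : Unit => D.output) := fun _ k hk => D.wf_output k hk
  have ho := wiresOK_shiftWire hφ hout
  refine ⟨toCircuit (gs ++ D.gates.map (reloc φ gs.length)) (shiftWire φ gs.length D.output)
    (hwf.append_reloc (wf_gates D) hφ) (fun k hk => ?_), rfl, rfl⟩
  have := ho () k hk
  simp only [List.length_append, List.length_map]
  exact this

/-- The composite computes `D` on the values carried by the wires `φ`. -/
theorem eval_top (gs : List (Gate ι)) (D : Circuit ι') (φ : ι' → ι ⊕ ℕ) (hφ : WiresOK gs.length φ)
    (E : Circuit ι) (hEg : E.gates = gs ++ D.gates.map (reloc φ gs.length))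
    (hEo : E.output = shiftWire φ gs.length D.output) (x : ι → Bool) :
    E.eval x = D.eval (fun i => wireOf x (vals gs x) (φ i)) := by
  rw [circuit_eval, circuit_eval, hEg, hEo, vals_append_reloc gs D.gates φ hφ x,
    wireOf_shiftWire x _ _ (length_vals gs x) φ hφ]

/-- The composite is over any basis containing the prefix gates and the gates of `D`. -/
theorem isOver_top {B : Set GateFn} (gs : List (Gate ι)) (hgs : ∀ g ∈ gs, g.fn ∈ B)
    (D : Circuit ι') (hD : D.IsOver B) (φ : ι' → ι ⊕ ℕ) (L : ℕ) (E : Circuit ι)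
    (hEg : E.gates = gs ++ D.gates.map (reloc φ L)) : E.IsOver B := by
  intro g hg
  rw [hEg, List.mem_append, List.mem_map] at hg
  rcases hg with hg | ⟨g', hg', rfl⟩
  · exact hgs g hg
  · rw [reloc_fn]
    exact hD g' hg'

/-- The composite has `|gs| + |D|` gates. -/
theorem size_top (gs : List (Gate ι)) (D : Circuit ι') (φ : ι' → ι ⊕ ℕ) (L : ℕ) (E : Circuit ι)
    (hEg : E.gates = gs ++ D.gates.map (reloc φ L)) : E.size = D.size + gs.length := by
  simp only [Circuit.size, hEg, List.length_append, List.length_map]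
  omega

/-- **`τ ⊕ σ` along an equivariant wiring** — the general composition lemma. Let the program
`gs' = gs ++ D.gates.map (reloc φ |gs|)` relocate a circuit `D` (inputs `ι'`) behind `gs` along the
wiring `φ : ι' → wires of gs`. If `τ` satisfies the gate conditions of an induced automorphism on
`gs` (extending the variable map `π`), `σ` is an automorphism of `D` extending `π' : ι' → ι'`, and the
wiring INTERTWINES the two, `relabelWire π τ (φ i) = φ (π' i)`, then `τ ⊕ σ` satisfies the gate
conditions on `gs'` (extending `π`), agrees with `τ` below `|gs|`, and fixes the shifted output of `D`.
Special cases: `π' = id, σ = 1` (hard-wiring ANY circuit onto `τ`-fixed wires: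
`exists_isInducedAut_top`) and `φ = inl, π' = π` (appending a symmetric circuit: `exists_snocPerm`). -/
theorem exists_relocPerm (gs : List (Gate ι)) (hwf : WF gs) (D : Circuit ι') (φ : ι' → ι ⊕ ℕ)
    (hφ : WiresOK gs.length φ) (π : ι → ι) (τ : Equiv.Perm (Fin gs.length))
    (haut : ∀ j : Fin gs.length, (gs[τ j]).fn = (gs[j]).fn ∧
      (List.ofFn (gs[τ j]).args).Perm ((List.ofFn (gs[j]).args).map (Circuit.relabelWire π τ)))
    (π' : ι' → ι') (σ : Equiv.Perm (Fin D.gates.length)) (hσ : D.IsInducedAut π' σ)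
    (hφπ : ∀ i, Circuit.relabelWire π τ (φ i) = φ (π' i))
    (gs' : List (Gate ι)) (hgs' : gs' = gs ++ D.gates.map (reloc φ gs.length)) :
    ∃ θ : Equiv.Perm (Fin gs'.length),
      (∀ k, k < gs.length → Circuit.relabelGate θ k = Circuit.relabelGate τ k) ∧
      Circuit.relabelWire π θ (shiftWire φ gs.length D.output) = shiftWire φ gs.length D.output ∧
      ∀ j : Fin gs'.length, (gs'[θ j]).fn = (gs'[j]).fn ∧
        (List.ofFn (gs'[θ j]).args).Perm ((List.ofFn (gs'[j]).args).map (Circuit.relabelWire π θ)) := by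
  subst hgs'
  have hN : (gs ++ D.gates.map (reloc φ gs.length)).length = D.gates.length + gs.length := by
    simp only [List.length_append, List.length_map]
    omega
  obtain ⟨θ, hθ⟩ := exists_sumPerm hN τ σ
  have hagree : ∀ k, k < gs.length → Circuit.relabelGate θ k = Circuit.relabelGate τ k :=
    fun k hk => by rw [hθ, if_pos hk]
  -- the key identity: relabelling by `(π, θ)` after shifting = shifting after relabelling by `(π', σ)`
  have hcomm : ∀ w : ι' ⊕ ℕ, Circuit.relabelWire π θ (shiftWire φ gs.length w) =
      shiftWire φ gs.length (Circuit.relabelWire π' σ w) := by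
    intro w
    cases w with
    | inl i =>
      show Circuit.relabelWire π θ (φ i) = φ (π' i)
      rw [relabelWire_eq_of_refs_lt π τ θ hagree (φ i) (fun k hk => hφ i k hk), hφπ i]
    | inr k =>
      show Circuit.relabelWire π θ (Sum.inr (k + gs.length)) =
        Sum.inr (Circuit.relabelGate σ k + gs.length)
      rw [Circuit.relabelWire_inr, hθ, if_neg (by omega), Nat.add_sub_cancel]
  refine ⟨θ, hagree, by rw [hcomm, hσ.1], ?_⟩
  rintro ⟨j, hj⟩
  simp only [Fin.getElem_fin]
  have hjv : ((θ ⟨j, hj⟩ : Fin _) : ℕ) = Circuit.relabelGate θ j :=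
    (Circuit.relabelGate_of_lt θ hj).symm
  rcases Nat.lt_or_ge j gs.length with hjL | hjL
  · -- a prefix gate: `θ` acts as `τ`, and on its wires the two relabellings agree
    have hv : ((θ ⟨j, hj⟩ : Fin _) : ℕ) = (τ ⟨j, hjL⟩ : ℕ) := by
      rw [hjv, hagree j hjL, Circuit.relabelGate_of_lt τ hjL]
    rw [getElem_congr_idx hv]
    rw [List.getElem_append_left (τ ⟨j, hjL⟩).2, List.getElem_append_left hjL]
    obtain ⟨hfn, hperm⟩ := haut ⟨j, hjL⟩
    simp only [Fin.getElem_fin] at hfn hperm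
    refine ⟨hfn, ?_⟩
    have hmap : (List.ofFn (gs[j]).args).map (Circuit.relabelWire π θ) =
        (List.ofFn (gs[j]).args).map (Circuit.relabelWire π τ) :=
      List.map_congr_left fun w hw => relabelWire_eq_of_refs_lt π τ θ hagree w
        (fun k hk => (refs_lt_of_wf hwf hjL hw k hk).trans hjL)
    rw [hmap]
    exact hperm
  · -- a relocated gate `k + |gs|` of `D`: goes to `σ k + |gs|`
    obtain ⟨k, rfl⟩ : ∃ k, j = k + gs.length := ⟨j - gs.length, by omega⟩
    have hk : k < D.gates.length := by
      rw [hN] at hj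
      omega
    have hv : ((θ ⟨k + gs.length, hj⟩ : Fin _) : ℕ) = (σ ⟨k, hk⟩ : ℕ) + gs.length := by
      rw [hjv, hθ, if_neg (by omega), Nat.add_sub_cancel, Circuit.relabelGate_of_lt σ hk]
    rw [getElem_congr_idx hv]
    rw [getElem_append_map_add gs D.gates (reloc φ gs.length) (σ ⟨k, hk⟩) (σ ⟨k, hk⟩).2,
      getElem_append_map_add gs D.gates (reloc φ gs.length) k hk]
    obtain ⟨hfn, hperm⟩ := hσ.2 ⟨k, hk⟩
    simp only [Fin.getElem_fin] at hfn hperm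
    refine ⟨by rw [reloc_fn, reloc_fn]; exact hfn, ?_⟩
    rw [ofFn_reloc_args, ofFn_reloc_args]
    have hmm : ((List.ofFn (D.gates[k]).args).map (Circuit.relabelWire π' σ)).map
          (shiftWire φ gs.length) =
        ((List.ofFn (D.gates[k]).args).map (shiftWire φ gs.length)).map
          (Circuit.relabelWire π θ) := by
      rw [List.map_map, List.map_map]
      exact List.map_congr_left fun w _ => (hcomm w).symm
    rw [← hmm]
    exact hperm.map _

/-- **`τ ⊕ id` is an automorphism of the composite.** If `τ` satisfies the gate conditions on the
prefix `gs` (extending the variable map `π`) and fixes every wire `φ i`, then the composite of `gs`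
with ANY circuit `D` hard-wired onto the wires `φ` has the automorphism `τ ⊕ id` extending `π`. -/
theorem exists_isInducedAut_top (gs : List (Gate ι)) (hwf : WF gs) (D : Circuit ι')
    (φ : ι' → ι ⊕ ℕ) (hφ : WiresOK gs.length φ) (E : Circuit ι)
    (hEg : E.gates = gs ++ D.gates.map (reloc φ gs.length))
    (hEo : E.output = shiftWire φ gs.length D.output)
    (π : ι → ι) (τ : Equiv.Perm (Fin gs.length))
    (hfix : ∀ i, Circuit.relabelWire π τ (φ i) = φ i)
    (haut : ∀ j : Fin gs.length, (gs[τ j]).fn = (gs[j]).fn ∧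
      (List.ofFn (gs[τ j]).args).Perm ((List.ofFn (gs[j]).args).map (Circuit.relabelWire π τ))) :
    ∃ θ : Equiv.Perm (Fin E.gates.length), E.IsInducedAut π θ := by
  obtain ⟨Eg, Eo, hEwf, hEo'⟩ := E
  dsimp only at hEg hEo
  subst hEg hEo
  obtain ⟨θ, -, hout, hgates⟩ := exists_relocPerm gs hwf D φ hφ π τ haut _root_.id 1
    (Circuit.isInducedAut_id_one D) hfix _ rfl
  exact ⟨θ, hout, hgates⟩

/-- **Hard-wiring onto a symmetric prefix is symmetric (matrix inputs).** If every `ρ ∈ Γ` extends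
to a gate permutation of the prefix satisfying the gate conditions and fixing the wires `φ i`, then
the composite with any `D` is `Γ`-symmetric. -/
theorem isSymmetricUnder_top {m : ℕ} (Γ : Set (Equiv.Perm (Fin m)))
    (gs : List (Gate (Fin m × Fin m))) (hwf : WF gs) (D : Circuit ι')
    (φ : ι' → (Fin m × Fin m) ⊕ ℕ) (hφ : WiresOK gs.length φ) (E : Circuit (Fin m × Fin m))
    (hEg : E.gates = gs ++ D.gates.map (reloc φ gs.length))
    (hEo : E.output = shiftWire φ gs.length D.output)
    (hsym : ∀ ρ ∈ Γ, ∃ τ : Equiv.Perm (Fin gs.length),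
      (∀ i, Circuit.relabelWire (fun q : Fin m × Fin m => (ρ q.1, ρ q.2)) τ (φ i) = φ i) ∧
      ∀ j : Fin gs.length, (gs[τ j]).fn = (gs[j]).fn ∧
        (List.ofFn (gs[τ j]).args).Perm ((List.ofFn (gs[j]).args).map
          (Circuit.relabelWire (fun q : Fin m × Fin m => (ρ q.1, ρ q.2)) τ))) :
    E.IsSymmetricUnder Γ := by
  intro ρ hρ
  obtain ⟨τ, hfix, haut⟩ := hsym ρ hρ
  exact exists_isInducedAut_top gs hwf D φ hφ E hEg hEo _ τ hfix haut

end Top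

/-! ### Appending a symmetric circuit to a symmetric prefix (`τ ⊕ σ`) -/

section Snoc

variable {ι : Type*}

/-- The prefix extended by `C` (relocated behind `gs`, reading the inputs directly) is well formed. -/
theorem wf_snoc (gs : List (Gate ι)) (hwf : WF gs) (C : Circuit ι) :
    WF (gs ++ C.gates.map (reloc Sum.inl gs.length)) :=
  hwf.append_reloc (wf_gates C) (wiresOK_inl gs.length _root_.id)

/-- Its new designated wire, the shifted output of `C`, is a valid wire. -/
theorem snocOut_lt (gs : List (Gate ι)) (C : Circuit ι) (k : ℕ)
    (hk : shiftWire (Sum.inl : ι → ι ⊕ ℕ) gs.length C.output = Sum.inr k) :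
    k < (gs ++ C.gates.map (reloc Sum.inl gs.length)).length := by
  cases hC : C.output with
  | inl i => rw [hC] at hk; cases hk
  | inr k' =>
    rw [hC] at hk
    simp only [shiftWire, Sum.inr.injEq] at hk
    have := C.wf_output k' hC
    simp only [List.length_append, List.length_map]
    omega

/-- The values of the extended prefix: those of `gs`, then those of `C`; in particular the new
designated wire carries `C.eval x` and the old wires keep their values. -/
theorem vals_snoc (gs : List (Gate ι)) (C : Circuit ι) (x : ι → Bool) :
    vals (gs ++ C.gates.map (reloc Sum.inl gs.length)) x = vals gs x ++ vals C.gates x := by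
  rw [vals_append_reloc gs C.gates Sum.inl (wiresOK_inl gs.length _root_.id) x]
  rfl

/-- The new designated wire of the extended prefix carries `C.eval x`. -/
theorem wireOf_snoc_new (gs : List (Gate ι)) (C : Circuit ι) (x : ι → Bool) :
    wireOf x (vals (gs ++ C.gates.map (reloc Sum.inl gs.length)) x)
      (shiftWire Sum.inl gs.length C.output) = C.eval x := by
  rw [vals_snoc, wireOf_shiftWire x _ _ (length_vals gs x) Sum.inl (wiresOK_inl gs.length _root_.id),
    circuit_eval]
  rfl

/-- Wires of the old prefix keep their values in the extended prefix. -/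
theorem wireOf_snoc_old (gs : List (Gate ι)) (C : Circuit ι) (x : ι → Bool) (w : ι ⊕ ℕ)
    (hw : ∀ k, w = Sum.inr k → k < gs.length) :
    wireOf x (vals (gs ++ C.gates.map (reloc Sum.inl gs.length)) x) w = wireOf x (vals gs x) w := by
  rw [vals_snoc]
  exact wireOf_append_of_lt x _ _ w (fun k hk => by rw [length_vals]; exact hw k hk)

/-- **`τ ⊕ σ` is an automorphism of the extended prefix.** If `τ` satisfies the gate conditions on
`gs` extending `π` and `σ` is an automorphism of `C` extending `π`, then `τ ⊕ σ` satisfies the gate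
conditions on `gs ++ C` (relocated), fixes the new designated wire (the shifted output of `C`) and
every wire below `|gs|` that `τ` fixed. -/
theorem exists_snocPerm (gs : List (Gate ι)) (hwf : WF gs) (C : Circuit ι) (π : ι → ι)
    (τ : Equiv.Perm (Fin gs.length))
    (haut : ∀ j : Fin gs.length, (gs[τ j]).fn = (gs[j]).fn ∧
      (List.ofFn (gs[τ j]).args).Perm ((List.ofFn (gs[j]).args).map (Circuit.relabelWire π τ)))
    (σ : Equiv.Perm (Fin C.gates.length)) (hσ : C.IsInducedAut π σ)
    (gs' : List (Gate ι)) (hgs' : gs' = gs ++ C.gates.map (reloc Sum.inl gs.length)) :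
    ∃ θ : Equiv.Perm (Fin gs'.length),
      (∀ k, k < gs.length → Circuit.relabelGate θ k = Circuit.relabelGate τ k) ∧
      Circuit.relabelWire π θ (shiftWire Sum.inl gs.length C.output) =
        shiftWire Sum.inl gs.length C.output ∧
      (∀ w : ι ⊕ ℕ, (∀ k, w = Sum.inr k → k < gs.length) → Circuit.relabelWire π τ w = w →
        Circuit.relabelWire π θ w = w) ∧
      ∀ j : Fin gs'.length, (gs'[θ j]).fn = (gs'[j]).fn ∧
        (List.ofFn (gs'[θ j]).args).Perm ((List.ofFn (gs'[j]).args).map (Circuit.relabelWire π θ)) := by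
  obtain ⟨θ, hagree, hout, hgates⟩ := exists_relocPerm gs hwf C Sum.inl (wiresOK_inl gs.length _root_.id)
    π τ haut π σ hσ (fun _ => rfl) gs' hgs'
  exact ⟨θ, hagree, hout, fun w hw hfix => by
    rw [relabelWire_eq_of_refs_lt π τ θ hagree w hw, hfix], hgates⟩

end Snoc

end Summit.PneNP.WindowBarrier.Negative
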